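import Literature.AlgebraicGeometry.Resolution.MarkedIdealsLemmas
import Literature.AlgebraicGeometry.Resolution.RegularLocalOrder
import HarnessLib

/-!
# Arithmetic of marked ideals: sums, products, their supports and controlled transforms

Topic: `Literature/AlgebraicGeometry/Resolution`. Bierstone–Grigoriev–Milman–Włodarczyk,
*Effective Hironaka resolution and its complexity*, arXiv:1206.3090, **§3.7** ("all marked
ideals are defined for the smooth variety `X` and the same set of exceptional divisors `E`"):

* `MarkedIdeal.prod` — **§3.7 (2)**: `(𝓘, μ_𝓘) · (𝓙, μ_𝓙) := (𝓘·𝓙, μ_𝓘 + μ_𝓙)`;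
* `MarkedIdeal.sum` — **§3.7 (1)**, binary case of the printed general formula
  `(𝓘_1, μ_1) + ⋯ + (𝓘_m, μ_m) := (Σᵢ 𝓘ᵢ^{Π_{j≠i} μ_j}, Π μ_j)`:
  `(𝓘, μ) + (𝓙, ν) := (𝓘^ν + 𝓙^μ, μν)` (the printed binary display
  "`(𝓘^{μ_𝓘} + 𝓙^{μ_𝓘}, μ_𝓘 μ_𝓙)`" has its exponents garbled; the general formula is the one used);
* `support_inter_support_subset_support_sum`, `mem_support_sum_iff` — **Lemma 3.7.1 (1)**, first
  sentence: `supp(sum) = supp(𝓘, μ) ∩ supp(𝓙, ν)`; `⊇` always, `⊆` at points with regular local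
  ring and `μ, ν ≥ 1` (`ord_x(𝓘ᵉ) ≥ e·p ⇔ ord_x(𝓘) ≥ p` in a regular local ring,
  `RegularLocalOrder.lean`, BGMW Ex. 3.4.2);
* `support_inter_support_subset_support_prod` — **Lemma 3.7.1 (2)**, first sentence, in the
  (correct) direction `supp(𝓘, μ) ∩ supp(𝓙, ν) ⊆ supp((𝓘, μ)·(𝓙, ν))` (the print has `⊇`, which
  fails e.g. for `(𝔪², 1)·(𝒪_X, 1) = (𝔪², 2)`; only `⊆` is used, for centres inside both supports);
* the **"moreover" clauses for one blow-up** `σ` with centre `C` and exceptional ideal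
  `𝓘(D) = σ^*𝓘_C` effective Cartier, whenever the total transforms are divisible as required
  (`σ^*𝓘 ⊆ 𝓘(D)^μ`, automatic for admissible centres by Lemma 3.2.1):
  `colon_pow_mul_eq` (`(𝓘(D)ⁿ·𝓐 : 𝓘(D)ⁿ) = 𝓐`), `controlledTransform_pow`
  (`σᶜ(𝓘ᵉ, eμ) = σᶜ(𝓘, μ)ᵉ`), `controlledTransform_mul` (`σᶜ(𝓘𝓙, μ+ν) = σᶜ(𝓘,μ)σᶜ(𝓙,ν)`),
  `controlledTransform_sup` (`σᶜ(𝓘+𝓙, μ) = σᶜ(𝓘,μ) + σᶜ(𝓙,μ)`), and on marked ideals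
  `transform_prod`, `transform_sum`:
  `[(𝓘,μ)·(𝓙,ν)]' = (𝓘,μ)'·(𝓙,ν)'`, `[(𝓘,μ)+(𝓙,ν)]' = (𝓘,μ)'+(𝓙,ν)'`.

* `stalkIdeal_sup` — `(𝓘 + 𝓙)_x = 𝓘_x + 𝓙_x`.

## Sources

* [BGMW 2011] §3.7, Lemma 3.7.1; Ex. 3.4.2; Lemma 3.2.1 (pp. 6–8, arXiv numbering).
  [BierstoneGrigorievMilmanWlodarczyk2011]
-/

namespace Literature.AlgebraicGeometry.Resolution

open CategoryTheory _root_.AlgebraicGeometry TopologicalSpace IsLocalRing Opposite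

universe u

variable {X : Scheme.{u}}

/-- **Stalks of a sum**: `(𝓘 + 𝓙)_x = 𝓘_x + 𝓙_x`. [folklore] -/
theorem stalkIdeal_sup (I J : X.IdealSheafData) (x : X) :
    stalkIdeal (I ⊔ J) x = stalkIdeal I x ⊔ stalkIdeal J x := by
  obtain ⟨U, hU, hxU, -⟩ :=
    exists_isAffineOpen_mem_and_subset (X := X) (x := x) (U := ⊤) (Opens.mem_top x)
  rw [stalkIdeal_eq_map_germ _ ⟨U, hU⟩ hxU, stalkIdeal_eq_map_germ I ⟨U, hU⟩ hxU,
    stalkIdeal_eq_map_germ J ⟨U, hU⟩ hxU, Scheme.IdealSheafData.ideal_sup, Pi.sup_apply,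
    Ideal.map_sup]

namespace MarkedIdeal

/-! ## §3.7: products and sums -/

/-- **BGMW §3.7 (2), product of marked ideals** (same boundary `E`, taken from the first
factor): `(𝓘, μ_𝓘) · (𝓙, μ_𝓙) := (𝓘 · 𝓙, μ_𝓘 + μ_𝓙)`. [cite: BierstoneGrigorievMilmanWlodarczyk2011, §3.7 (2)] -/
def prod (M N : MarkedIdeal X) : MarkedIdeal X :=
  ⟨M.ideal * N.ideal, M.boundary, M.mult + N.mult⟩

/-- **BGMW §3.7 (1), sum of two marked ideals** (same boundary `E`, taken from the first
summand): `(𝓘, μ) + (𝓙, ν) := (𝓘^ν + 𝓙^μ, μ ν)` — the case `m = 2` of the printed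
`(Σᵢ 𝓘ᵢ^{Π_{j≠i} μ_j}, Π_j μ_j)` ("the operation of addition is not associative").
[cite: BierstoneGrigorievMilmanWlodarczyk2011, §3.7 (1)] -/
def sum (M N : MarkedIdeal X) : MarkedIdeal X :=
  ⟨M.ideal ^ N.mult ⊔ N.ideal ^ M.mult, M.boundary, M.mult * N.mult⟩

/-- Unfolding `prod`. [folklore] -/
@[simp] theorem prod_ideal (M N : MarkedIdeal X) : (M.prod N).ideal = M.ideal * N.ideal := rfl
/-- Unfolding `prod`. [folklore] -/
@[simp] theorem prod_boundary (M N : MarkedIdeal X) : (M.prod N).boundary = M.boundary := rfl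
/-- Unfolding `prod`. [folklore] -/
@[simp] theorem prod_mult (M N : MarkedIdeal X) : (M.prod N).mult = M.mult + N.mult := rfl
/-- Unfolding `sum`. [folklore] -/
@[simp] theorem sum_ideal (M N : MarkedIdeal X) :
    (M.sum N).ideal = M.ideal ^ N.mult ⊔ N.ideal ^ M.mult := rfl
/-- Unfolding `sum`. [folklore] -/
@[simp] theorem sum_boundary (M N : MarkedIdeal X) : (M.sum N).boundary = M.boundary := rfl
/-- Unfolding `sum`. [folklore] -/
@[simp] theorem sum_mult (M N : MarkedIdeal X) : (M.sum N).mult = M.mult * N.mult := rfl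

/-! ## Lemma 3.7.1, first sentences: supports -/

/-- **BGMW Lemma 3.7.1 (2)** (direction `⊆`, the one that holds and is used):
`supp(𝓘, μ) ∩ supp(𝓙, ν) ⊆ supp((𝓘, μ) · (𝓙, ν))` (`𝓘_x ⊆ 𝔪^μ`, `𝓙_x ⊆ 𝔪^ν ⇒ (𝓘𝓙)_x ⊆ 𝔪^{μ+ν}`).
[cite: BierstoneGrigorievMilmanWlodarczyk2011, Lemma 3.7.1 (2)] -/
theorem support_inter_support_subset_support_prod (M N : MarkedIdeal X) :
    M.support ∩ N.support ⊆ (M.prod N).support := by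
  rintro x ⟨hM, hN⟩
  rw [mem_support_iff] at hM hN ⊢
  rw [prod_ideal, prod_mult, stalkIdeal_mul, pow_add]
  exact Ideal.mul_mono hM hN

/-- **BGMW Lemma 3.7.1 (1)**, `⊇` (every point): `supp(𝓘, μ) ∩ supp(𝓙, ν) ⊆ supp((𝓘, μ) + (𝓙, ν))`.
[cite: BierstoneGrigorievMilmanWlodarczyk2011, Lemma 3.7.1 (1)] -/
theorem support_inter_support_subset_support_sum (M N : MarkedIdeal X) :
    M.support ∩ N.support ⊆ (M.sum N).support := by
  rintro x ⟨hM, hN⟩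
  rw [mem_support_iff] at hM hN ⊢
  rw [sum_ideal, sum_mult, stalkIdeal_sup, stalkIdeal_pow, stalkIdeal_pow]
  refine sup_le ?_ ?_
  · rw [pow_mul]
    exact Ideal.pow_right_mono hM _
  · rw [mul_comm, pow_mul]
    exact Ideal.pow_right_mono hN _

/-- **BGMW Lemma 3.7.1 (1), `supp((𝓘, μ) + (𝓙, ν)) = supp(𝓘, μ) ∩ supp(𝓙, ν)`** at a point with
regular local ring (BGMW: `X` smooth), for `μ, ν ≥ 1`: `𝓘_x^ν ⊆ 𝔪^{μν} ⇔ 𝓘_x ⊆ 𝔪^μ` in a regular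
local ring. [cite: BierstoneGrigorievMilmanWlodarczyk2011, Lemma 3.7.1 (1)] -/
theorem mem_support_sum_iff (M N : MarkedIdeal X) {x : X} [IsRegularLocalRing (X.presheaf.stalk x)]
    (hμ : 1 ≤ M.mult) (hν : 1 ≤ N.mult) :
    x ∈ (M.sum N).support ↔ x ∈ M.support ∧ x ∈ N.support := by
  refine ⟨fun h => ?_, fun h => support_inter_support_subset_support_sum M N h⟩
  rw [mem_support_iff, sum_ideal, sum_mult, stalkIdeal_sup, stalkIdeal_pow, stalkIdeal_pow,
    sup_le_iff] at h
  rw [mem_support_iff, mem_support_iff]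
  obtain ⟨h1, h2⟩ := h
  rw [mul_comm] at h1
  exact ⟨(Ideal.pow_le_pow_mul_iff hν).mp h1, (Ideal.pow_le_pow_mul_iff hμ).mp h2⟩

end MarkedIdeal

/-! ## Controlled transforms of powers, products and sums (one blow-up) -/

section Transform

variable {X X' : Scheme.{u}} [IsLocallyNoetherian X'] (σ : X' ⟶ X) (C : X.IdealSheafData)

/-- **Cancellation of an effective Cartier factor**: `(𝓓ⁿ · 𝓐 : 𝓓ⁿ) = 𝓐` for `𝓓` effective
Cartier (locally `𝓓 = (g)` with `g` a nonzerodivisor) on a locally Noetherian scheme. [folklore] -/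
theorem colon_pow_mul_eq {D : X'.IdealSheafData} (hD : IsEffectiveCartier D) (A : X'.IdealSheafData)
    (n : ℕ) : colon (D ^ n * A) (D ^ n) = A := by
  choose U hxU g hg hDU using hD
  have hcov : ⨆ x, (U x : X'.Opens) = ⊤ :=
    top_le_iff.mp fun x _ => Opens.mem_iSup.mpr ⟨x, hxU x⟩
  refine Scheme.IdealSheafData.ext_of_iSup_eq_top U hcov fun x => ?_
  have hDn : (D ^ n).ideal (U x) = Ideal.span {g x ^ n} := by
    rw [Scheme.IdealSheafData.ideal_pow, Pi.pow_apply, hDU, Ideal.span_singleton_pow]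
  have hgn : g x ^ n ∈ nonZeroDivisors Γ(X', U x) := pow_mem (hg x) n
  rw [ideal_colon, Scheme.IdealSheafData.ideal_mul, Pi.mul_apply, hDn]
  ext a
  rw [Ideal.mem_colon_span_singleton, Ideal.mem_span_singleton_mul]
  constructor
  · rintro ⟨b, hb, hab⟩
    rw [mul_comm a] at hab
    rwa [← (mul_cancel_left_mem_nonZeroDivisors hgn).mp hab]
  · exact fun ha => ⟨a, ha, mul_comm _ _⟩

variable {σ C}

/-- **`σᶜ(𝓘ᵉ, eμ) = σᶜ(𝓘, μ)ᵉ`** when `σ^*𝓘 ⊆ 𝓘(D)^μ` and `𝓘(D)` is effective Cartier (the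
multiplicativity behind BGMW Lemma 3.7.1 and Lemma 3.8.1 (2): `σ^*(𝓘ᵉ) = (𝓘(D)^μ σᶜ𝓘)ᵉ`).
[cite: BierstoneGrigorievMilmanWlodarczyk2011, Lemma 3.7.1] -/
theorem controlledTransform_pow (hD : IsEffectiveCartier (C.comap σ)) {I : X.IdealSheafData} {μ : ℕ}
    (h : I.comap σ ≤ C.comap σ ^ μ) (e : ℕ) :
    controlledTransform σ C (I ^ e) (e * μ) = controlledTransform σ C I μ ^ e := by
  have hI := pow_mul_controlledTransform_eq σ C hD h
  set A := controlledTransform σ C I μ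
  unfold controlledTransform
  rw [comap_pow, ← hI, mul_pow, ← pow_mul, mul_comm μ e]
  exact colon_pow_mul_eq hD (A ^ e) (e * μ)

/-- **`σᶜ(𝓘·𝓙, μ + ν) = σᶜ(𝓘, μ) · σᶜ(𝓙, ν)`** when `σ^*𝓘 ⊆ 𝓘(D)^μ`, `σ^*𝓙 ⊆ 𝓘(D)^ν` and `𝓘(D)` is
effective Cartier (BGMW Lemma 3.7.1 (2), "moreover", for one blow-up).
[cite: BierstoneGrigorievMilmanWlodarczyk2011, Lemma 3.7.1 (2)] -/
theorem controlledTransform_mul (hD : IsEffectiveCartier (C.comap σ)) {I J : X.IdealSheafData}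
    {μ ν : ℕ} (hI : I.comap σ ≤ C.comap σ ^ μ) (hJ : J.comap σ ≤ C.comap σ ^ ν) :
    controlledTransform σ C (I * J) (μ + ν) =
      controlledTransform σ C I μ * controlledTransform σ C J ν := by
  have hI' := pow_mul_controlledTransform_eq σ C hD hI
  have hJ' := pow_mul_controlledTransform_eq σ C hD hJ
  set A := controlledTransform σ C I μ
  set B := controlledTransform σ C J ν
  unfold controlledTransform
  rw [comap_mul, ← hI', ← hJ',
    show C.comap σ ^ μ * A * (C.comap σ ^ ν * B) = C.comap σ ^ (μ + ν) * (A * B) by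
      rw [pow_add, mul_mul_mul_comm]]
  exact colon_pow_mul_eq hD (A * B) (μ + ν)

/-- **`σᶜ(𝓘 + 𝓙, μ) = σᶜ(𝓘, μ) + σᶜ(𝓙, μ)`** when `σ^*𝓘, σ^*𝓙 ⊆ 𝓘(D)^μ` and `𝓘(D)` is effective
Cartier (BGMW Lemma 3.7.1 (1), "moreover", for one blow-up).
[cite: BierstoneGrigorievMilmanWlodarczyk2011, Lemma 3.7.1 (1)] -/
theorem controlledTransform_sup (hD : IsEffectiveCartier (C.comap σ)) {I J : X.IdealSheafData}
    {μ : ℕ} (hI : I.comap σ ≤ C.comap σ ^ μ) (hJ : J.comap σ ≤ C.comap σ ^ μ) :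
    controlledTransform σ C (I ⊔ J) μ =
      controlledTransform σ C I μ ⊔ controlledTransform σ C J μ := by
  have hI' := pow_mul_controlledTransform_eq σ C hD hI
  have hJ' := pow_mul_controlledTransform_eq σ C hD hJ
  set A := controlledTransform σ C I μ
  set B := controlledTransform σ C J μ
  unfold controlledTransform
  rw [Scheme.IdealSheafData.comap_sup, ← hI', ← hJ', ← Scheme.IdealSheafData.mul_inf]
  exact colon_pow_mul_eq hD (A ⊔ B) μ

namespace MarkedIdeal

/-- **BGMW Lemma 3.7.1 (2), "moreover", one blow-up**: for a blow-up `σ` with exceptional ideal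
`𝓘(D)` effective Cartier and total transforms divisible by `𝓘(D)^μ`, resp. `𝓘(D)^ν` (e.g. a
centre inside both supports, Lemma 3.2.1), `[(𝓘, μ)·(𝓙, ν)]' = (𝓘, μ)' · (𝓙, ν)'`.
[cite: BierstoneGrigorievMilmanWlodarczyk2011, Lemma 3.7.1 (2)] -/
theorem transform_prod (hD : IsEffectiveCartier (C.comap σ)) (M N : MarkedIdeal X)
    (hM : M.ideal.comap σ ≤ C.comap σ ^ M.mult) (hN : N.ideal.comap σ ≤ C.comap σ ^ N.mult) :
    (M.prod N).transform σ C = (M.transform σ C).prod (N.transform σ C) := by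
  simp only [MarkedIdeal.transform, MarkedIdeal.prod, mk.injEq, and_true]
  exact controlledTransform_mul hD hM hN

/-- **BGMW Lemma 3.7.1 (1), "moreover", one blow-up**: under the same divisibility hypotheses,
`[(𝓘, μ) + (𝓙, ν)]' = (𝓘, μ)' + (𝓙, ν)'` (controlled transforms with multiplicity `μν`).
[cite: BierstoneGrigorievMilmanWlodarczyk2011, Lemma 3.7.1 (1)] -/
theorem transform_sum (hD : IsEffectiveCartier (C.comap σ)) (M N : MarkedIdeal X)
    (hM : M.ideal.comap σ ≤ C.comap σ ^ M.mult) (hN : N.ideal.comap σ ≤ C.comap σ ^ N.mult) :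
    (M.sum N).transform σ C = (M.transform σ C).sum (N.transform σ C) := by
  simp only [MarkedIdeal.transform, MarkedIdeal.sum, mk.injEq, and_true]
  have hM' : (M.ideal ^ N.mult).comap σ ≤ C.comap σ ^ (M.mult * N.mult) := by
    rw [comap_pow, pow_mul]
    exact pow_le_pow_left' hM _
  have hN' : (N.ideal ^ M.mult).comap σ ≤ C.comap σ ^ (M.mult * N.mult) := by
    rw [comap_pow, mul_comm, pow_mul]
    exact pow_le_pow_left' hN _
  rw [controlledTransform_sup hD hM' hN', mul_comm M.mult N.mult, controlledTransform_pow hD hM,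
    mul_comm N.mult M.mult, controlledTransform_pow hD hN]

/-- For an admissible centre of both `M` and `N` (inside both supports, snc with the common
boundary) and a blow-up `σ` along it: `[(𝓘, μ)·(𝓙, ν)]' = (𝓘, μ)'·(𝓙, ν)'`.
[cite: BierstoneGrigorievMilmanWlodarczyk2011, Lemma 3.7.1 (2)] -/
theorem transform_prod_of_isBlowup (M N : MarkedIdeal X) (hE : N.boundary = M.boundary)
    (hsuppM : (C.support : Set X) ⊆ M.support) (hsuppN : (C.support : Set X) ⊆ N.support)
    (hsnc : HasSNCWith M.boundary C) (hσ : IsBlowup σ C) :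
    (M.prod N).transform σ C = (M.transform σ C).prod (N.transform σ C) :=
  transform_prod hσ.isEffectiveCartier M N (M.comap_ideal_le_pow hsuppM hsnc σ)
    (N.comap_ideal_le_pow hsuppN (hE ▸ hsnc) σ)

/-- For an admissible centre of both `M` and `N` and a blow-up `σ` along it:
`[(𝓘, μ) + (𝓙, ν)]' = (𝓘, μ)' + (𝓙, ν)'`. [cite: BierstoneGrigorievMilmanWlodarczyk2011, Lemma 3.7.1 (1)] -/
theorem transform_sum_of_isBlowup (M N : MarkedIdeal X) (hE : N.boundary = M.boundary)
    (hsuppM : (C.support : Set X) ⊆ M.support) (hsuppN : (C.support : Set X) ⊆ N.support)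
    (hsnc : HasSNCWith M.boundary C) (hσ : IsBlowup σ C) :
    (M.sum N).transform σ C = (M.transform σ C).sum (N.transform σ C) :=
  transform_sum hσ.isEffectiveCartier M N (M.comap_ideal_le_pow hsuppM hsnc σ)
    (N.comap_ideal_le_pow hsuppN (hE ▸ hsnc) σ)

end MarkedIdeal

end Transform

end Literature.AlgebraicGeometry.Resolution
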